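import Summits.HubbardSuperconductivity.HubbardSuperconductivity.Theses.AposterioriCapRg
import Literature.MathematicalPhysics.QuantumLattice.DWaveOrderParameterProofs
import Literature.MathematicalPhysics.QuantumLattice.PatchPairOperator
import Literature.MathematicalPhysics.QuantumLattice.HubbardGrandCanonicalDensity
import Literature.MathematicalPhysics.QuantumLattice.TorusCooperSum
import Literature.MathematicalPhysics.QuantumLattice.DWaveSourceFreeGainBound
import Literature.MathematicalPhysics.QuantumLattice.HubbardWave0Proofs

/-!
# Crux `FixedPointDWaveOrder` (item `stmt-HubbardSuperconductivity-1313`, route `AposterioriCapRg`):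
# no Koma–Tasaki `d`-wave order below the band, at EVERY repulsion `U ≥ 0`

Negative-side support lemmas from the standing disprover (cdisprove, generation 1) of the route target
`FixedPointDWaveOrder : ∃ U ∈ [2,3], ∃ δ ∈ [1/5,7/20], ∃ μ, (GC tracial density → 1-δ) ∧ HasDWaveOrder U μ`.
Nothing here asserts a Theses declaration; the object is the tree's Koma–Tasaki order parameter
`dWaveOrderParameter U μ = liminf_{h→0⁺} liminf_L Re ω_{L+1,h}(Δ_d)/(L+1)²` (`DWaveSource.lean`).

THE THEOREM (`dWaveOrderParameter_eq_zero_below_band`, `not_hasDWaveOrder_below_band`): for every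
`U ≥ 0` and every chemical potential `μ < -4` (below the bottom `-4` of the band `ε(k) = -2(cos k₁ + cos k₂)`),
`dWaveOrderParameter U μ = 0`, hence `¬ HasDWaveOrder U μ`. To the disprover's knowledge this is the first
`¬ HasDWaveOrder` theorem of the tree at INTERACTING coupling (the tree had the free slice `U = 0`,
`μ ∈ (-4,0)`: `NodalReduction.Negative.not_hasDWaveOrder_free`, via the BdG Cooper logarithm). For the
crux it is LOAD-BEARING ANALYSIS: in `∃ μ` the witness must lie in the band window — with the density
clause dropped, the `μ`-quantifier of `FixedPointDWaveOrder` still cannot be witnessed below `-4` at any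
`U ∈ [2,3]` (`not_exists_order_below_band_in_box`); the density clause and the order clause point at the
SAME region (inside the band), so neither is decoration for the other there, and the whole content of the
crux sits at band fillings, where no technique of the tree or of the printed record decides it.

PROOF (operator inequalities in momentum space, `L ≥ 3`; Koma–Tasaki's energy form of the order
parameter). With `g := -4 - μ > 0`, `b_k = c_{-k↓}c_{k↑}` (`pairMode`), `Δ_d = -2√2 Σ_k ĝ_d(k) b_k`
(`pairField_dWave_eq_smul_pairOperator`), `a_k := 2√2 h ĝ_d(k)`:
* (P1) `K_U - K_0 = U Σ_x n_{x↑}n_{x↓} ≥ 0`;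
* (P2) `K_0 - g N = Σ_{kσ} (ε_k + 4) n_{kσ} ≥ 0` (`hubbardTorusWith_zero_eq_sum_momentumNumber`, `ε_k ≥ -4`);
* (P3) `N - Σ_k b_k†b_k = Σ_k (n_{k↑} - b_k†b_k) + Σ_k n_{k↓} ≥ 0`, since `n_{k↑} - b_k†b_k = Y†Y`,
  `Y = c†_{-k↓}c_{k↑}` (CAR);
* (P4) `g Σ_k b_k†b_k - h(Δ_d + Δ_d†) + c_L(h) = Σ_k g⁻¹ (g b_k + a_k)†(g b_k + a_k) ≥ 0`,
  `c_L(h) = Σ_k a_k²/g ≤ 32 h² L²/g` (`|ĝ_d| ≤ 2`).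
Summing, `H_{L,h} + c_L(h) ≥ 0`, so `E₀(H_{L,h}) ≥ -32h²L²/g`, while `E₀(H_{L,0}) ≤ ⟨vac, K_U vac⟩ = 0`: the
sourced energy gain is QUADRATIC in `h` per site, uniformly in `L` (`groundEnergy_gain_le_below_band`), and
the tree's `dWaveOrderParameter_eq_zero_of_sublinear_gain` gives `m(U,μ) = 0`. (Physically: below the band
the unique `h = 0` ground state is the gapped vacuum; a gapped reference responds quadratically to the pair
source. The mirror statement above the top of the band, `μ > 4 + U`, holds by the particle–hole version of the
same four inequalities and is left to a later cycle.)

Sources: T. Koma, H. Tasaki, J. Stat. Phys. 76 (1994) 745, §1 (order parameter under a source; energy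
inequalities) [KomaTasaki1994]; the operator inequalities are folklore (completing the square; CAR).
Prose analysis: work file `Cruxes/FixedPointDWaveOrder/Disproof.lean`.
-/

noncomputable section

namespace Summit.HubbardSuperconductivity.FixedPointDWaveOrder.Negative

open Matrix Finset Filter Literature.MathematicalPhysics.QuantumLattice Literature.Probability.LatticeModels
open scoped Matrix.Norms.L2Operator ComplexOrder Topology

variable {L : ℕ} [NeZero L]

/-! ### 1. Per-mode operator inequalities -/

/-- `n_{k↑} - b_k† b_k = Y† Y` with `Y = c†_{-k↓} c_{k↑}` (CAR `c_{-k↓} c†_{-k↓} = 1 - c†_{-k↓} c_{-k↓}`). [folklore] -/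
theorem momentumNumber_sub_pairMode_sq (k : TorusSite 2 L) :
    momentumNumber k 0 - (pairMode k)ᴴ * pairMode k =
      (momentumCreation (-k) 1 * momentumAnnihilation k 0)ᴴ *
        (momentumCreation (-k) 1 * momentumAnnihilation k 0) := by
  have hcar := momentumAnnihilation_mul_momentumCreation (d := 2) (L := L) (-k) (-k) (1 : Fin 2) 1
  simp only [and_self, if_true] at hcar
  have hcc : (momentumCreation (-k) (1 : Fin 2) : Matrix (Finset (Orb (FermionTorus 2 L))) _ ℂ)ᴴ =
      momentumAnnihilation (-k) 1 := by
    rw [momentumCreation, conjTranspose_conjTranspose]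
  rw [pairMode_conjTranspose, pairMode, momentumNumber, conjTranspose_mul, hcc,
    momentumAnnihilation_conjTranspose]
  rw [Matrix.mul_assoc (momentumCreation k 0) (momentumAnnihilation (-k) 1),
    ← Matrix.mul_assoc (momentumAnnihilation (-k) 1), hcar]
  simp only [Matrix.sub_mul, Matrix.one_mul, Matrix.mul_sub, Matrix.mul_assoc]

/-- `b_k† b_k ≤ n_{k↑}` as operators. [folklore] -/
theorem posSemidef_momentumNumber_sub_pairMode (k : TorusSite 2 L) :
    (momentumNumber k 0 - (pairMode k)ᴴ * pairMode k).PosSemidef := by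
  rw [momentumNumber_sub_pairMode_sq]
  exact posSemidef_conjTranspose_mul_self _

/-- The completed square of a sourced pair mode: for real `g ≠ 0` and `a`,
`g b†b + a (b + b†) + (a²/g) 1 = g⁻¹ (g b + a 1)† (g b + a 1)`. [folklore] -/
theorem pairMode_square_identity (k : TorusSite 2 L) {g : ℝ} (hg : g ≠ 0) (a : ℝ) :
    (g : ℂ) • ((pairMode k)ᴴ * pairMode k) + (a : ℂ) • (pairMode k + (pairMode k)ᴴ) +
        ((a ^ 2 / g : ℝ) : ℂ) • (1 : Matrix (Finset (Orb (FermionTorus 2 L))) _ ℂ) =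
      ((g⁻¹ : ℝ) : ℂ) • (((g : ℂ) • pairMode k + (a : ℂ) • 1)ᴴ * ((g : ℂ) • pairMode k + (a : ℂ) • 1)) := by
  have hg' : (g : ℂ) ≠ 0 := Complex.ofReal_ne_zero.mpr hg
  simp only [conjTranspose_add, conjTranspose_smul, conjTranspose_one, Complex.star_def,
    Complex.conj_ofReal, Matrix.add_mul, Matrix.mul_add, Matrix.smul_mul, Matrix.mul_smul,
    Matrix.one_mul, Matrix.mul_one, smul_add, smul_smul]
  push_cast
  field_simp
  module

/-- Hence `g b†b + a (b + b†) + (a²/g) 1 ≥ 0` for `g > 0`. [folklore] -/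
theorem posSemidef_pairMode_square (k : TorusSite 2 L) {g : ℝ} (hg : 0 < g) (a : ℝ) :
    ((g : ℂ) • ((pairMode k)ᴴ * pairMode k) + (a : ℂ) • (pairMode k + (pairMode k)ᴴ) +
        ((a ^ 2 / g : ℝ) : ℂ) • (1 : Matrix (Finset (Orb (FermionTorus 2 L))) _ ℂ)).PosSemidef := by
  rw [pairMode_square_identity k hg.ne' a]
  exact posSemidef_ofReal_smul (posSemidef_conjTranspose_mul_self _) (inv_nonneg.mpr hg.le)

/-! ### 2. The four positive pieces -/

omit [NeZero L] in
/-- (P1) Repulsion is positive: `K_U - K_0 = U Σ_x n_{x↑}n_{x↓} ≥ 0` for `U ≥ 0`. [folklore] -/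
theorem posSemidef_hubbardTorusWith_sub_free {U : ℝ} (hU : 0 ≤ U) (μ : ℝ) :
    (hubbardTorusWith 2 L 1 U μ - hubbardTorusWith 2 L 1 0 μ).PosSemidef := by
  rw [hubbardTorusWith, hubbardTorusWith, hamiltonianWith_sub_hamiltonianWith, sub_zero]
  exact posSemidef_ofReal_smul (posSemidef_sum_numberOp_mul_numberOp (Λ := FermionTorus 2 L)) hU

/-- (P2) Below the band the free grand-canonical Hamiltonian dominates `(-4 - μ) N`:
`K_0 - (-4 - μ) N = Σ_{kσ} (ε_k + 4) n_{kσ} ≥ 0` (`ε_k ≥ -4`; momentum representation, `L ≥ 3`). [folklore] -/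
theorem posSemidef_free_sub_gap_smul_totalNumber (hL : 3 ≤ L) (μ : ℝ) :
    (hubbardTorusWith 2 L 1 0 μ - (((-4 - μ : ℝ)) : ℂ) • totalNumber).PosSemidef := by
  rw [hubbardTorusWith_zero_eq_sum_momentumNumber hL μ, totalNumber_eq_sum_momentumNumber,
    Finset.smul_sum, ← Finset.sum_sub_distrib]
  refine posSemidef_sum _ fun k _ => ?_
  rw [Finset.smul_sum, ← Finset.sum_sub_distrib]
  refine posSemidef_sum _ fun σ _ => ?_
  rw [← sub_smul, ← Complex.ofReal_sub]
  refine posSemidef_ofReal_smul (posSemidef_momentumNumber k σ) ?_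
  have := neg_four_le_torusBand L k
  linarith

/-- (P3) The pair modes are dominated by the particle number: `N - Σ_k b_k† b_k ≥ 0`
(`N = Σ_k (n_{k↑} + n_{k↓})` and `b_k†b_k ≤ n_{k↑}`). [folklore] -/
theorem posSemidef_totalNumber_sub_sum_pairMode :
    ((totalNumber : Matrix (Finset (Orb (FermionTorus 2 L))) _ ℂ) -
        ∑ k : TorusSite 2 L, (pairMode k)ᴴ * pairMode k).PosSemidef := by
  have hrepr : ((totalNumber : Matrix (Finset (Orb (FermionTorus 2 L))) _ ℂ) -
        ∑ k : TorusSite 2 L, (pairMode k)ᴴ * pairMode k) =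
      ∑ k : TorusSite 2 L, (momentumNumber k 0 - (pairMode k)ᴴ * pairMode k) +
        ∑ k : TorusSite 2 L, momentumNumber k 1 := by
    rw [totalNumber_eq_sum_momentumNumber]
    simp only [Fin.sum_univ_two, Finset.sum_add_distrib, Finset.sum_sub_distrib]
    abel
  rw [hrepr]
  exact (posSemidef_sum _ fun k _ => posSemidef_momentumNumber_sub_pairMode k).add
    (posSemidef_sum _ fun k _ => posSemidef_momentumNumber k 1)

/-- The source operator in momentum space: `-(Δ_d + Δ_d†) = 2√2 Σ_k ĝ_d(k) (b_k + b_k†)`. [cite: Scalapino1995, §2] -/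
theorem neg_pairField_add_conjTranspose_eq_sum :
    -(pairField dWaveFormFactor L + (pairField dWaveFormFactor L)ᴴ) =
      ∑ k : TorusSite 2 L, ((2 * Real.sqrt 2 * dWaveGap k : ℝ) : ℂ) • (pairMode k + (pairMode k)ᴴ) := by
  rw [pairField_dWave_eq_smul_pairOperator, pairOperator]
  simp only [conjTranspose_neg, conjTranspose_smul, conjTranspose_sum, Complex.star_def,
    Complex.conj_ofReal, neg_add_rev, neg_neg, Finset.smul_sum, smul_smul, smul_add,
    ← Complex.ofReal_mul, Finset.sum_add_distrib]
  abel

/-- The constant of the completed squares is quadratic in the source and extensive: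
`Σ_k (2√2 ĝ_d(k) h)²/g ≤ 32 h² L² / g` for `g > 0` (`|ĝ_d| ≤ 2`, `|Λ_L| = L²`). [folklore] -/
theorem sourceShift_le {g : ℝ} (hg : 0 < g) (h : ℝ) :
    ∑ k : TorusSite 2 L, (2 * Real.sqrt 2 * dWaveGap k * h) ^ 2 / g ≤ 32 * h ^ 2 / g * (L : ℝ) ^ 2 := by
  have hterm : ∀ k : TorusSite 2 L, (2 * Real.sqrt 2 * dWaveGap k * h) ^ 2 / g ≤ 32 * h ^ 2 / g := by
    intro k
    have h2 : Real.sqrt 2 ^ 2 = 2 := Real.sq_sqrt (by norm_num)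
    have hgk := abs_dWaveGap_le_two k
    have hsq : dWaveGap k ^ 2 ≤ 4 := by
      have := abs_le.mp hgk
      nlinarith
    rw [div_le_div_iff_of_pos_right hg]
    calc (2 * Real.sqrt 2 * dWaveGap k * h) ^ 2 = 8 * dWaveGap k ^ 2 * h ^ 2 := by ring_nf; rw [h2]; ring
      _ ≤ 8 * 4 * h ^ 2 := by gcongr
      _ = 32 * h ^ 2 := by ring
  calc ∑ k : TorusSite 2 L, (2 * Real.sqrt 2 * dWaveGap k * h) ^ 2 / g
      ≤ ∑ _k : TorusSite 2 L, 32 * h ^ 2 / g := Finset.sum_le_sum fun k _ => hterm k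
    _ = 32 * h ^ 2 / g * (L : ℝ) ^ 2 := by
      rw [Finset.sum_const, Finset.card_univ, card_torusSite_two, nsmul_eq_mul]
      push_cast
      ring

/-- (P4) The sourced pair modes complete to squares:
`g Σ_k b_k†b_k + h·[-(Δ_d + Δ_d†)] + (Σ_k a_k²/g) 1 = Σ_k g⁻¹ (g b_k + a_k)†(g b_k + a_k) ≥ 0`,
`a_k = 2√2 ĝ_d(k) h`. [folklore] -/
theorem posSemidef_pairModes_source_shift {g : ℝ} (hg : 0 < g) (h : ℝ) :
    ((g : ℂ) • ∑ k : TorusSite 2 L, (pairMode k)ᴴ * pairMode k +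
        (h : ℂ) • -(pairField dWaveFormFactor L + (pairField dWaveFormFactor L)ᴴ) +
        ((∑ k : TorusSite 2 L, (2 * Real.sqrt 2 * dWaveGap k * h) ^ 2 / g : ℝ) : ℂ) •
          (1 : Matrix (Finset (Orb (FermionTorus 2 L))) _ ℂ)).PosSemidef := by
  have hrepr : ((g : ℂ) • ∑ k : TorusSite 2 L, (pairMode k)ᴴ * pairMode k +
        (h : ℂ) • -(pairField dWaveFormFactor L + (pairField dWaveFormFactor L)ᴴ) +
        ((∑ k : TorusSite 2 L, (2 * Real.sqrt 2 * dWaveGap k * h) ^ 2 / g : ℝ) : ℂ) •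
          (1 : Matrix (Finset (Orb (FermionTorus 2 L))) _ ℂ)) =
      ∑ k : TorusSite 2 L, ((g : ℂ) • ((pairMode k)ᴴ * pairMode k) +
        ((2 * Real.sqrt 2 * dWaveGap k * h : ℝ) : ℂ) • (pairMode k + (pairMode k)ᴴ) +
        (((2 * Real.sqrt 2 * dWaveGap k * h) ^ 2 / g : ℝ) : ℂ) •
          (1 : Matrix (Finset (Orb (FermionTorus 2 L))) _ ℂ)) := by
    rw [neg_pairField_add_conjTranspose_eq_sum]
    simp only [Finset.smul_sum, Finset.sum_add_distrib, smul_smul, ← Complex.ofReal_mul,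
      Complex.ofReal_sum, Finset.sum_smul]
    refine congrArg₂ (· + ·) (congrArg₂ (· + ·) rfl (Finset.sum_congr rfl fun k _ => ?_)) rfl
    ring_nf
  rw [hrepr]
  exact posSemidef_sum _ fun k _ => posSemidef_pairMode_square k hg _

/-! ### 3. The operator inequality and the quadratic energy response -/

/-- **Below-band stability of the sourced torus.** For `L ≥ 3`, `U ≥ 0`, `μ < -4` and every real `h`:
`H_{L,h} + c_L(h) · 1 ≥ 0` with `H_{L,h} = dWaveSourceTorus L U μ h` and
`c_L(h) = Σ_k (2√2 ĝ_d(k) h)²/(-4-μ)` (sum of (P1)–(P4)). [cite: KomaTasaki1994, §1] -/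
theorem posSemidef_dWaveSourceTorus_add_shift (hL : 3 ≤ L) {U μ : ℝ} (hU : 0 ≤ U) (hμ : μ < -4)
    (h : ℝ) :
    (dWaveSourceTorus L U μ h +
        ((∑ k : TorusSite 2 L, (2 * Real.sqrt 2 * dWaveGap k * h) ^ 2 / (-4 - μ) : ℝ) : ℂ) •
          (1 : Matrix (Finset (Orb (FermionTorus 2 L))) _ ℂ)).PosSemidef := by
  have hg : 0 < -4 - μ := by linarith
  have h1 := posSemidef_hubbardTorusWith_sub_free (L := L) hU μ
  have h2 := posSemidef_free_sub_gap_smul_totalNumber hL μ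
  have h3 := posSemidef_ofReal_smul (posSemidef_totalNumber_sub_sum_pairMode (L := L)) hg.le
  have h4 := posSemidef_pairModes_source_shift (L := L) hg h
  have hsum := ((h1.add h2).add h3).add h4
  convert hsum using 1
  rw [dWaveSourceTorus_eq, smul_sub, smul_neg, sub_eq_add_neg]
  abel

/-- **Quadratic lower bound on the sourced ground energy below the band**:
`-32 h² L²/(-4-μ) ≤ -c_L(h) ≤ E₀(H_{L,h})` (positivity of the tracial ground state on
`H_{L,h} + c_L(h)`). [cite: KomaTasaki1994, §1] -/
theorem neg_le_groundEnergy_dWaveSourceTorus (hL : 3 ≤ L) {U μ : ℝ} (hU : 0 ≤ U) (hμ : μ < -4) (h : ℝ) :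
    -(32 * h ^ 2 / (-4 - μ) * (L : ℝ) ^ 2) ≤ (dWaveSourceTorus L U μ h).groundEnergy := by
  have hg : 0 < -4 - μ := by linarith
  have hA : (dWaveSourceTorus L U μ h).IsHermitian :=
    dWaveSourceTorus_isHermitian L (isHermitian_hubbardTorusWith L 1 U μ) h
  have hpos := Matrix.groundStateFunctional_nonneg_of_posSemidef (dWaveSourceTorus L U μ h)
    (posSemidef_dWaveSourceTorus_add_shift hL hU hμ h)
  rw [map_add, map_smul, Matrix.groundStateFunctional_hamiltonian hA,
    Matrix.groundStateFunctional_one hA] at hpos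
  obtain ⟨hre, -⟩ := Complex.nonneg_iff.mp hpos
  simp only [Complex.add_re, Complex.ofReal_re, smul_eq_mul, mul_one] at hre
  have hc := sourceShift_le (L := L) hg h
  linarith

omit [NeZero L] in
/-- The source-free grand-canonical ground energy is non-positive at every `U, μ` (the vacuum is a trial
state with energy `0`). [folklore] -/
theorem groundEnergy_hubbardTorusWith_le_zero (U μ : ℝ) :
    (hubbardTorusWith 2 L 1 U μ).groundEnergy ≤ 0 := by
  have hvac : star (vacuum : Fock (Orb (FermionTorus 2 L))) ⬝ᵥ vacuum = 1 := by
    simp [vacuum, dotProduct_single]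
  have h := Matrix.groundEnergy_le_rayleigh_holds (isHermitian_hubbardTorusWith L 1 U μ) vacuum hvac
  have hN : (totalNumber : Matrix (Finset (Orb (FermionTorus 2 L))) _ ℂ) *ᵥ
      (vacuum : Fock (Orb (FermionTorus 2 L))) = 0 := by
    have han : ∀ i : Orb (FermionTorus 2 L),
        annihilation i *ᵥ (vacuum : Fock (Orb (FermionTorus 2 L))) = 0 :=
      fun i => annihilation_mulVec_vacuum_holds i
    simp only [totalNumber, numberOp, Matrix.sum_mulVec, ← mulVec_mulVec, han, mulVec_zero,
      Finset.sum_const_zero]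
  have hK : hubbardTorusWith 2 L 1 U μ *ᵥ (vacuum : Fock (Orb (FermionTorus 2 L))) = 0 := by
    rw [hubbardTorusWith, hamiltonianWith, sub_mulVec, hamiltonian_mulVec_vacuum, smul_mulVec, hN,
      smul_zero, sub_zero]
  rw [hK, dotProduct_zero, Complex.zero_re] at h
  exact h

/-- **Quadratic sourced energy gain below the band**: for `L ≥ 3`, `U ≥ 0`, `μ < -4` and every real `h`,
`E₀(H_{L,0}) - E₀(H_{L,h}) ≤ 32 h² L² / (-4 - μ)`. [cite: KomaTasaki1994, §1] -/
theorem groundEnergy_gain_le_below_band (hL : 3 ≤ L) {U μ : ℝ} (hU : 0 ≤ U) (hμ : μ < -4) (h : ℝ) :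
    (dWaveSourceTorus L U μ 0).groundEnergy - (dWaveSourceTorus L U μ h).groundEnergy ≤
      32 * h ^ 2 / (-4 - μ) * (L : ℝ) ^ 2 := by
  have h0 : (dWaveSourceTorus L U μ 0).groundEnergy ≤ 0 := by
    rw [dWaveSourceTorus_zero]; exact groundEnergy_hubbardTorusWith_le_zero U μ
  have h1 := neg_le_groundEnergy_dWaveSourceTorus hL hU hμ h
  linarith

/-! ### 4. No `d`-wave order below the band -/

/-- **No Koma–Tasaki `d`-wave order below the band, at every repulsion.** For all `U ≥ 0` and `μ < -4`,
`dWaveOrderParameter U μ = 0`: the sourced energy gain is `O(h²)` per site uniformly in the volume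
(`groundEnergy_gain_le_below_band`), hence sub-linear, and the tree's
`dWaveOrderParameter_eq_zero_of_sublinear_gain` applies. [cite: KomaTasaki1994, §1] -/
theorem dWaveOrderParameter_eq_zero_below_band {U μ : ℝ} (hU : 0 ≤ U) (hμ : μ < -4) :
    dWaveOrderParameter U μ = 0 := by
  refine dWaveOrderParameter_eq_zero_of_sublinear_gain U μ (fun h => 32 * (2 * h) ^ 2 / (-4 - μ)) ?_ ?_
  · have hcont : Tendsto (fun h : ℝ => 64 * h / (-4 - μ)) (𝓝[>] 0) (𝓝 0) := by
      have : Tendsto (fun h : ℝ => 64 * h / (-4 - μ)) (𝓝 0) (𝓝 (64 * 0 / (-4 - μ))) :=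
        ((continuous_const.mul continuous_id).div_const _).tendsto 0
      rw [mul_zero, zero_div] at this
      exact this.mono_left nhdsWithin_le_nhds
    refine hcont.congr' ?_
    filter_upwards [self_mem_nhdsWithin] with h hh
    have hh' : (h : ℝ) ≠ 0 := ne_of_gt hh
    field_simp
    ring
  · filter_upwards [self_mem_nhdsWithin] with h _hh
    filter_upwards [eventually_ge_atTop 2] with L hL2
    have hL3 : 3 ≤ L + 1 := by omega
    exact groundEnergy_gain_le_below_band hL3 hU hμ (2 * h)

/-- Hence **`¬ HasDWaveOrder U μ` for every `U ≥ 0` and every `μ < -4`**. [cite: KomaTasaki1994, §1] -/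
theorem not_hasDWaveOrder_below_band {U μ : ℝ} (hU : 0 ≤ U) (hμ : μ < -4) : ¬ HasDWaveOrder U μ := by
  rw [hasDWaveOrder_iff, dWaveOrderParameter_eq_zero_below_band hU hμ]
  exact lt_irrefl 0

/-! ### 5. Reading for the crux `FixedPointDWaveOrder` -/

/-- **Load-bearing reading for `FixedPointDWaveOrder`.** In the crux
`∃ U ∈ [2,3], ∃ δ ∈ [1/5,7/20], ∃ μ, DensityClause ∧ HasDWaveOrder U μ` the `μ`-witness cannot lie below the
band even after the density clause is DROPPED: `¬ ∃ U ∈ [2,3], ∃ μ < -4, HasDWaveOrder U μ`. (So a proof of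
the crux must place `μ` in the band window by the order clause alone; the density clause `→ 1 - δ` and the
order clause constrain `μ` to the same region.) [cite: KomaTasaki1994, §1] -/
theorem not_exists_order_below_band_in_box :
    ¬ ∃ U ∈ Set.Icc (2:ℝ) 3, ∃ μ : ℝ, μ < -4 ∧ HasDWaveOrder U μ := by
  rintro ⟨U, hU, μ, hμ, hord⟩
  exact not_hasDWaveOrder_below_band (by linarith [hU.1]) hμ hord

/-- The same at every repulsion: no witness `(U, μ)` of Koma–Tasaki `d`-wave order has `U ≥ 0` and
`μ < -4`. [cite: KomaTasaki1994, §1] -/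
theorem not_exists_order_below_band :
    ¬ ∃ U : ℝ, 0 ≤ U ∧ ∃ μ : ℝ, μ < -4 ∧ HasDWaveOrder U μ := by
  rintro ⟨U, hU, μ, hμ, hord⟩
  exact not_hasDWaveOrder_below_band hU hμ hord

end Summit.HubbardSuperconductivity.FixedPointDWaveOrder.Negative
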